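import Mathlib
import Summits.KontsevichZagierPeriods.Zeta5Search.RecordCell1516
import HarnessLib

/-!
# ζ(5) search — RECORD-RAY DOMINANCE above θ = 16: the class bound `LB(b(n),p)` dominates `refund − N_p` for `16n < p ≤ 41n`, all `n`

Cell `pub-zeta5` (HONEST FRAMING: systematic search; no irrationality claim unless certified), TRACK «DENOM-LAW» D1 prover seat
(denom-prover-d1 g11, `HOME/denom-law/prover-d1/ATTEMPT-11.md` §4).  Towards the tree's `@[conjecture]` node
`ClusterValuation.RecordRayDominance` (`refund − N_p ≤ casLB(b(n),p)` on Brown–Zudilin's record ray `b(n) = n·(41;17,…,11)`, all `n`,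
primes `5 ≤ p ≤ 41n`): the counting halves `p ≤ 12n` are the tree's `recordRayDominance_small` / `recordRayDominance_le_twelve`; above
`θ = p/n = 14` the inequality is TIGHT and needs the exact class structure.  This file reads it off on the four TOP cells, in the frame of
P1 g5's record atlas (`CellA.dep7`, `netExp_bRec`, `classSet_bRec_three` of `Cell1516`):

* `16n < p ≤ 17n`: every pole class has `ν ≥ −2`, every multipole class `E ≥ −2` (`LB ≥ −1 = 1 − 2`);
* `17n < p ≤ 18n`: `ν ≥ −1`, no multipole class (`LB ≥ 0 = 1 − 1`);
* `18n < p ≤ 25n`: every pole class is TAME (`ν ≥ 0`), no multipole class, the class of `17n` has a pole (`LB ≥ 1 = refund − 0`);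
* `25n < p ≤ 41n`: `ν ≥ 0`, no multipole class (`LB ≥ 0 = 0 − 0`).

The regions in `x < p`: `x < 11n` (a zero below a single pole at `x + p ≤ 29n`, or no pole: TAME), `11n ≤ x < 12n` (a neutral point below
a pole at `x + p ≤ 29n`: the only non-tame singles, `E = netExp(x+p) ≥ −2 / −1 / none`), `12n ≤ x < 13n` (a simple pole at level 0; the
second point `x + p` is a pole only for `p ≤ 17n`: the only multipole classes, `E ≥ −2`), `13n ≤ x` (a pole at level 0, nothing above: TAME).
Main results: `casLB_ge17`, `casLB_ge18`, `casLB_ge25`, `casLB_ge41`; the dominance itself (with `refund`, `N_p` read on the ray) is assembled in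
`RecordRayDominanceProof`.
Integer bookkeeping; nothing about irrationality.
-/

open Finset

namespace Summit.KontsevichZagierPeriods.Zeta5Search.RecordRayTop

open Summit.KontsevichZagierPeriods.Zeta5Search.ClusterValuation
open Summit.KontsevichZagierPeriods.Zeta5Search.CasoratianValuation (InPolytope pairFloors refund shift casoratian)
open Summit.KontsevichZagierPeriods.Zeta5Search.CellA
open Summit.KontsevichZagierPeriods.Zeta5Search.Cell1516 (classSet_bRec_three)

/-! ### §1 Depth bounds on the record ray -/

/-- At least three blocks on `[13n, 28n]`. -/
theorem three_le_dep7 {n q : ℕ} (h1 : 13 * n ≤ q) (h2 : q ≤ 28 * n) : 3 ≤ dep7 n q := by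
  unfold dep7; split_ifs <;> omega

/-- At least two blocks on `[12n, 29n]`. -/
theorem two_le_dep7 {n q : ℕ} (h1 : 12 * n ≤ q) (h2 : q ≤ 29 * n) : 2 ≤ dep7 n q := by
  unfold dep7; split_ifs <;> omega

/-- At most one block above `29n`. -/
theorem dep7_le_one_high {n q : ℕ} (h : 29 * n < q) : dep7 n q ≤ 1 := by
  unfold dep7; split_ifs <;> omega

/-- At most two blocks above `28n`. -/
theorem dep7_le_two_high {n q : ℕ} (h : 28 * n < q) : dep7 n q ≤ 2 := by
  unfold dep7; split_ifs <;> omega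

/-- At most three blocks above `27n`. -/
theorem dep7_le_three_high {n q : ℕ} (h : 27 * n < q) : dep7 n q ≤ 3 := by
  unfold dep7; split_ifs <;> omega

/-! ### §2 The classes above `θ = 16`, region by region -/

section Regions

variable {n p x : ℕ} (hn : 1 ≤ n) (hp : 16 * n < p) (hp41 : p ≤ 41 * n) (hx : x < p)

include hp hx in
/-- The class of `x`: its points among `x`, `x + p`, `x + 2p` (the last two only when `≤ 41n`). -/
theorem mem_class_cases {s : ℕ} (hs : s ∈ classSet (bRec n) p x) :
    s = x ∨ (s = x + p ∧ x + p ≤ 41 * n) ∨ (s = x + 2 * p ∧ x + 2 * p ≤ 41 * n) := by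
  rw [mem_classSet_iff, bRec_zero_toNat] at hs
  obtain ⟨hs41, k, hk⟩ := hs
  have hk0 : 0 ≤ k := by
    by_contra hneg
    push Not at hneg
    have : (p : ℤ) * k ≤ (p : ℤ) * (-1) := mul_le_mul_of_nonneg_left (by omega) (by omega)
    omega
  have hk3 : k < 3 := by
    by_contra hge
    push Not at hge
    have : (p : ℤ) * 3 ≤ (p : ℤ) * k := mul_le_mul_of_nonneg_left hge (by omega)
    omega
  interval_cases k
  · left; omega
  · right; left; constructor <;> omega
  · right; right; constructor <;> omega

include hp41 hx in
/-- `x` lies in its class. -/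
theorem self_mem_class : x ∈ classSet (bRec n) p x := by
  rw [mem_classSet_iff, bRec_zero_toNat]; exact ⟨by omega, 0, by ring⟩

/-- `x + p` lies in the class when `x + p ≤ 41n`. -/
theorem add_mem_class (h : x + p ≤ 41 * n) : x + p ∈ classSet (bRec n) p x := by
  rw [mem_classSet_iff, bRec_zero_toNat]; exact ⟨h, 1, by push_cast; ring⟩

include hn hp hp41 hx in
/-- **Region `x < 11n`**: `x` is a zero; the class is TAME with exactly one pole, or has no pole. -/
theorem R0 (hx11 : x < 11 * n) :
    classPoleCount (bRec n) p x = 0 ∨ (classPoleCount (bRec n) p x = 1 ∧ 0 ≤ classNu (bRec n) p x) := by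
  have ex : netExp (bRec n) x = 1 := by
    rw [netExp_bRec_of_ne n x (by omega), dep7_low hx11]; norm_num
  -- a possible third point is a zero
  have ex2 : x + 2 * p ≤ 41 * n → 0 ≤ netExp (bRec n) (x + 2 * p) := fun h => by
    rw [netExp_bRec_of_ne n (x + 2 * p) (by omega), dep7_high (by omega)]; norm_num
  by_cases hpole : x + p ≤ 41 * n ∧ netExp (bRec n) (x + p) < 0
  · -- one pole at `x + p`, a zero below, a possible zero above: tame
    obtain ⟨h41, exp⟩ := hpole
    right
    have hfilter : (classSet (bRec n) p x).filter (fun s => netExp (bRec n) s < 0) = {x + p} := by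
      ext s
      simp only [mem_filter, mem_singleton]
      constructor
      · rintro ⟨hs, hneg⟩
        rcases mem_class_cases hp hx hs with rfl | ⟨rfl, -⟩ | ⟨rfl, h3⟩
        · omega
        · rfl
        · have := ex2 h3; omega
      · rintro rfl; exact ⟨add_mem_class h41, exp⟩
    have hcount : classPoleCount (bRec n) p x = 1 := by
      unfold classPoleCount; rw [hfilter, card_singleton]
    have htm : tameSingle (bRec n) p x = true := by
      rw [tameSingle_iff]
      refine ⟨x + p, add_mem_class h41, exp, Or.inr fun s hs hlt => ?_⟩
      rcases mem_class_cases hp hx hs with rfl | ⟨rfl, -⟩ | ⟨rfl, -⟩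
      · rw [ex]; norm_num
      · omega
      · omega
    refine ⟨hcount, ?_⟩
    unfold classNu
    rw [if_pos ⟨hcount, htm⟩]
    exact le_max_right _ _
  · -- no pole at all
    left
    unfold classPoleCount
    rw [card_eq_zero, filter_eq_empty_iff]
    intro s hs hneg
    rcases mem_class_cases hp hx hs with rfl | ⟨rfl, h41⟩ | ⟨rfl, h3⟩
    · omega
    · exact hpole ⟨h41, hneg⟩
    · have := ex2 h3; omega

include hn hp hp41 hx in
/-- **Region `11n ≤ x < 12n`**: `x` is neutral; at most one pole (`x + p`, when `x + p ≤ 29n`), of net exponent `1 − dep7(x+p)`;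
so `E_x ≥ 1 − dep7(x + p)` when `x + p ≤ 41n`, and there is no multipole class. -/
theorem R1 (hx11 : 11 * n ≤ x) (hx12 : x < 12 * n) :
    classPoleCount (bRec n) p x ≤ 1 ∧
      (1 ≤ classPoleCount (bRec n) p x → x + p ≤ 29 * n ∧ 1 - (dep7 n (x + p) : ℤ) ≤ classExp (bRec n) p x) := by
  have ex : netExp (bRec n) x = 0 := by
    rw [netExp_bRec_of_ne n x (by omega), dep7_lower (by norm_num : 1 ≤ 7) (by omega) (by omega)]; norm_num
  have h3 : ¬ x + 2 * p ≤ 41 * n := by omega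
  -- the pole set is inside `{x + p}`
  have hsub : (classSet (bRec n) p x).filter (fun s => netExp (bRec n) s < 0) ⊆ {x + p} := by
    intro s hs
    rw [mem_filter] at hs
    rcases mem_class_cases hp hx hs.1 with rfl | ⟨rfl, -⟩ | ⟨rfl, h3'⟩
    · omega
    · exact mem_singleton_self _
    · exact absurd h3' h3
  have hle : classPoleCount (bRec n) p x ≤ 1 := by
    unfold classPoleCount; exact (card_le_card hsub).trans (card_singleton _).le
  refine ⟨hle, fun h1 => ?_⟩
  -- if there is a pole, it is `x + p` with `x + p ≤ 29n`
  obtain ⟨s, hs⟩ := card_pos.1 (by unfold classPoleCount at h1; exact h1)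
  have hs' := hs
  rw [mem_filter] at hs'
  have hsx : s = x + p := mem_singleton.1 (hsub hs)
  subst hsx
  have h41 : x + p ≤ 41 * n := by
    have := hs'.1; rw [mem_classSet_iff, bRec_zero_toNat] at this; exact this.1
  have h29 : x + p ≤ 29 * n := by
    by_contra hgt
    push Not at hgt
    have := hs'.2
    rw [netExp_bRec] at this
    have := dep7_le_one_high (n := n) (q := x + p) hgt
    split_ifs at * <;> omega
  refine ⟨h29, ?_⟩
  -- `E_x ≥ netExp x + netExp (x+p) = 0 + (1 − dep7 + [centre])`
  have hsum : netExp (bRec n) x + netExp (bRec n) (x + p) ≤ classExp (bRec n) p x := by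
    refine le_trans (le_of_eq ?_) (classExp_ge_sum _ _ _)
    have hcs : classSet (bRec n) p x = {x, x + p} := by
      ext s
      constructor
      · intro hs
        rcases mem_class_cases hp hx hs with rfl | ⟨rfl, -⟩ | ⟨rfl, h3'⟩
        · simp
        · simp
        · exact absurd h3' h3
      · intro hs
        simp only [mem_insert, mem_singleton] at hs
        rcases hs with rfl | rfl
        · exact self_mem_class hp41 hx
        · exact add_mem_class h41
    rw [hcs, sum_pair (by omega)]
  have hp' : 1 - (dep7 n (x + p) : ℤ) ≤ netExp (bRec n) (x + p) := by
    rw [netExp_bRec]; split_ifs <;> omega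
  linarith

include hp hp41 hx in
/-- **Region `12n ≤ x < 13n`**: `x` is a simple pole at level `0`; `E_x ≥ −1 + (1 − dep7(x+p))` if `x + p ≤ 41n`, else `E_x ≥ −1`;
the class is TAME unless `x + p` is a pole (then `x + p ≤ 29n`, so `p ≤ 17n`). -/
theorem R2 (hx12 : 12 * n ≤ x) (hx13 : x < 13 * n) :
    (-2 : ℤ) ≤ classExp (bRec n) p x ∧ (17 * n < p → 0 ≤ classNu (bRec n) p x ∧ classPoleCount (bRec n) p x = 1) := by
  have ex : netExp (bRec n) x = -1 := by
    rw [netExp_bRec_of_ne n x (by omega), dep7_lower (by norm_num : 2 ≤ 7) (by omega) (by omega)]; norm_num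
  have h3 : ¬ x + 2 * p ≤ 41 * n := by omega
  have hxp : x + p ≤ 41 * n → -1 ≤ netExp (bRec n) (x + p) := fun h => by
    rw [netExp_bRec]; have := dep7_le_two_high (n := n) (q := x + p) (by omega); split_ifs <;> omega
  -- the class and its exponent
  by_cases h41 : x + p ≤ 41 * n
  · have hcs : classSet (bRec n) p x = {x, x + p} := by
      ext s
      constructor
      · intro hs
        rcases mem_class_cases hp hx hs with rfl | ⟨rfl, -⟩ | ⟨rfl, h3'⟩
        · simp
        · simp
        · exact absurd h3' h3
      · intro hs
        simp only [mem_insert, mem_singleton] at hs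
        rcases hs with rfl | rfl
        · exact self_mem_class hp41 hx
        · exact add_mem_class h41
    have hE : (-2 : ℤ) ≤ classExp (bRec n) p x := by
      refine le_trans ?_ (classExp_ge_sum _ _ _)
      rw [hcs, sum_pair (by omega), ex]
      linarith [hxp h41]
    refine ⟨hE, fun hp17 => ?_⟩
    -- for `p > 17n` the point `x + p > 29n` is not a pole: tame single pole at level 0
    have exp0 : 0 ≤ netExp (bRec n) (x + p) := by
      rw [netExp_bRec]; have := dep7_le_one_high (n := n) (q := x + p) (by omega); split_ifs <;> omega
    have hfilter : (classSet (bRec n) p x).filter (fun s => netExp (bRec n) s < 0) = {x} := by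
      rw [hcs, filter_insert, if_pos (by rw [ex]; norm_num), filter_singleton, if_neg (by omega), insert_empty]
    have hcount : classPoleCount (bRec n) p x = 1 := by unfold classPoleCount; rw [hfilter, card_singleton]
    have htm : tameSingle (bRec n) p x = true := by
      rw [tameSingle_iff]; exact ⟨x, self_mem_class hp41 hx, by rw [ex]; norm_num, Or.inl hx⟩
    refine ⟨?_, hcount⟩
    unfold classNu; rw [if_pos ⟨hcount, htm⟩]; exact le_max_right _ _
  · have hcs : classSet (bRec n) p x = {x} := by
      ext s
      constructor
      · intro hs
        rcases mem_class_cases hp hx hs with rfl | ⟨rfl, h41'⟩ | ⟨rfl, h3'⟩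
        · simp
        · exact absurd h41' h41
        · exact absurd h3' h3
      · intro hs; rw [mem_singleton] at hs; subst hs; exact self_mem_class hp41 hx
    have hE : (-2 : ℤ) ≤ classExp (bRec n) p x := by
      refine le_trans ?_ (classExp_ge_sum _ _ _)
      rw [hcs, sum_singleton, ex]; norm_num
    have hfilter : (classSet (bRec n) p x).filter (fun s => netExp (bRec n) s < 0) = {x} := by
      rw [hcs, filter_singleton, if_pos (by rw [ex]; norm_num)]
    have hcount : classPoleCount (bRec n) p x = 1 := by unfold classPoleCount; rw [hfilter, card_singleton]
    have htm : tameSingle (bRec n) p x = true := by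
      rw [tameSingle_iff]; exact ⟨x, self_mem_class hp41 hx, by rw [ex]; norm_num, Or.inl hx⟩
    refine ⟨hE, fun _ => ⟨?_, hcount⟩⟩
    unfold classNu; rw [if_pos ⟨hcount, htm⟩]; exact le_max_right _ _

include hp hp41 hx in
/-- **Region `13n ≤ x ≤ 29n`** (`x < p`): `x` is a pole at level `0` and the possible second point `x + p > 29n` is not a pole:
exactly one pole, TAME, `ν ≥ 0`. -/
theorem R3 (hx13 : 13 * n ≤ x) (hx29 : x ≤ 29 * n) : classPoleCount (bRec n) p x = 1 ∧ 0 ≤ classNu (bRec n) p x := by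
  have h3 : ¬ x + 2 * p ≤ 41 * n := by omega
  have ex : netExp (bRec n) x < 0 := by
    rw [netExp_bRec]
    have := two_le_dep7 (n := n) (q := x) (by omega) hx29
    have := three_le_dep7 (n := n) (q := x) hx13
    by_cases hx28 : x ≤ 28 * n
    · have := this hx28; split_ifs <;> omega
    · split_ifs with hc
      · omega
      · omega
  have exp : x + p ≤ 41 * n → 0 ≤ netExp (bRec n) (x + p) := fun h => by
    rw [netExp_bRec]; have := dep7_le_one_high (n := n) (q := x + p) (by omega); split_ifs <;> omega
  have hfilter : (classSet (bRec n) p x).filter (fun s => netExp (bRec n) s < 0) = {x} := by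
    ext s
    simp only [mem_filter, mem_singleton]
    constructor
    · rintro ⟨hs, hneg⟩
      rcases mem_class_cases hp hx hs with rfl | ⟨rfl, h41⟩ | ⟨rfl, h3'⟩
      · rfl
      · have := exp h41; omega
      · exact absurd h3' h3
    · rintro rfl; exact ⟨self_mem_class hp41 hx, ex⟩
  have hcount : classPoleCount (bRec n) p x = 1 := by unfold classPoleCount; rw [hfilter, card_singleton]
  have htm : tameSingle (bRec n) p x = true := by
    rw [tameSingle_iff]; exact ⟨x, self_mem_class hp41 hx, ex, Or.inl hx⟩
  refine ⟨hcount, ?_⟩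
  unfold classNu; rw [if_pos ⟨hcount, htm⟩]; exact le_max_right _ _

include hp hx in
/-- **Region `29n < x`** (`x < p`): no pole at all (`dep7 x ≤ 1`, and `x + p > 41n`). -/
theorem R4 (hx29 : 29 * n < x) : classPoleCount (bRec n) p x = 0 := by
  unfold classPoleCount
  rw [card_eq_zero, filter_eq_empty_iff]
  intro s hs hneg
  rcases mem_class_cases hp hx hs with rfl | ⟨rfl, h41⟩ | ⟨rfl, h3⟩
  · rw [netExp_bRec] at hneg
    have := dep7_le_one_high hx29
    split_ifs at hneg <;> omega
  · omega
  · omega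

include hn hp hp41 hx in
/-- **No multipole class above `θ = 16`, except in region `12n ≤ x < 13n`; every multipole class has `E ≥ −2`.** -/
theorem multipole_bound (h2 : 2 ≤ classPoleCount (bRec n) p x) : 12 * n ≤ x ∧ x < 13 * n ∧ (-2 : ℤ) ≤ classExp (bRec n) p x := by
  by_cases hx11 : x < 11 * n
  · rcases R0 hn hp hp41 hx hx11 with h | ⟨h, -⟩ <;> omega
  by_cases hx12 : x < 12 * n
  · have := (R1 hn hp hp41 hx (by omega) hx12).1; omega
  by_cases hx13 : x < 13 * n
  · exact ⟨by omega, hx13, (R2 hp hp41 hx (by omega) hx13).1⟩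
  by_cases hx29 : x ≤ 29 * n
  · have := (R3 hp hp41 hx (by omega) hx29).1; omega
  · have := R4 hp hx (by omega); omega

include hn hp hp41 hx in
/-- **Every pole class above `θ = 16` has `ν ≥ −2`; `ν ≥ −1` if `p > 17n`; `ν ≥ 0` if `p > 18n`.** -/
theorem classNu_bound (h1 : 1 ≤ classPoleCount (bRec n) p x) :
    (-2 : ℤ) ≤ classNu (bRec n) p x ∧ (17 * n < p → (-1 : ℤ) ≤ classNu (bRec n) p x) ∧
      (18 * n < p → (0 : ℤ) ≤ classNu (bRec n) p x) := by
  by_cases hx11 : x < 11 * n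
  · rcases R0 hn hp hp41 hx hx11 with h | ⟨-, h⟩
    · omega
    · exact ⟨by linarith, fun _ => by linarith, fun _ => h⟩
  by_cases hx12 : x < 12 * n
  · obtain ⟨-, hR⟩ := R1 hn hp hp41 hx (by omega) hx12
    obtain ⟨h29, hE⟩ := hR h1
    have hν := classExp_le_classNu (bRec n) p x
    have hd3 := dep7_le_three_high (n := n) (q := x + p) (by omega)
    refine ⟨?_, fun hp17 => ?_, fun hp18 => ?_⟩
    · have : (dep7 n (x + p) : ℤ) ≤ 3 := by exact_mod_cast hd3
      linarith
    · have hd2 := dep7_le_two_high (n := n) (q := x + p) (by omega)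
      have : (dep7 n (x + p) : ℤ) ≤ 2 := by exact_mod_cast hd2
      linarith
    · exfalso; omega
  by_cases hx13 : x < 13 * n
  · obtain ⟨hE, hR⟩ := R2 hp hp41 hx (by omega) hx13
    have hν := classExp_le_classNu (bRec n) p x
    refine ⟨by linarith, fun hp17 => ?_, fun hp18 => (hR (by omega)).1⟩
    exact le_trans (by norm_num) (hR hp17).1
  by_cases hx29 : x ≤ 29 * n
  · have h := (R3 hp hp41 hx (by omega) hx29).2
    exact ⟨by linarith, fun _ => by linarith, fun _ => h⟩
  · have := R4 hp hx (by omega); omega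

end Regions

/-! ### §3 The class bound on the four top cells -/

/-- `d(b(n)) = 25n ≥ p` on the cells below `25n`: the row term `0` is absent. -/
theorem not_dOf_lt {n p : ℕ} (h : p ≤ 25 * n) : ¬ WedgeDictionary.dOf (bRec n) < (p : ℤ) := by
  rw [dOf_bRec]; omega

/-- **`casLB(b(n),p) ≥ −1`** for `16n < p ≤ 17n`. -/
theorem casLB_ge17 {n p : ℕ} (hn : 1 ≤ n) (hp : 16 * n < p) (hp' : p ≤ 17 * n) : -1 ≤ casLB (bRec n) p := by
  rcases casLB_ge_or_noPole (bRec n) p (-2) 1 (fun x hx h1 => (classNu_bound hn hp (by omega) hx h1).1) le_rfl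
      (fun x hx h2 => by linarith [(multipole_bound hn hp (by omega) hx h2).2.2]) (fun h => absurd h (not_dOf_lt (by omega)))
    with ⟨h0, -⟩ | h
  · rw [h0]; norm_num
  · linarith

/-- **`casLB(b(n),p) ≥ 0`** for `17n < p ≤ 18n`. -/
theorem casLB_ge18 {n p : ℕ} (hn : 1 ≤ n) (hp : 17 * n < p) (hp' : p ≤ 18 * n) : 0 ≤ casLB (bRec n) p := by
  rcases casLB_ge_or_noPole (bRec n) p (-1) 1 (fun x hx h1 => (classNu_bound hn (by omega) (by omega) hx h1).2.1 hp) le_rfl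
      (fun x hx h2 => by linarith [(multipole_bound hn (by omega) (by omega) hx h2).2.2])
      (fun h => absurd h (not_dOf_lt (by omega))) with ⟨h0, -⟩ | h
  · rw [h0]
  · linarith

/-- **`casLB(b(n),p) ≥ 1`** for `18n < p ≤ 25n` (the class of `17n` has a pole, so the no-pole case is excluded). -/
theorem casLB_ge25 {n p : ℕ} (hn : 1 ≤ n) (hp : 18 * n < p) (hp' : p ≤ 25 * n) : 1 ≤ casLB (bRec n) p := by
  rcases casLB_ge_or_noPole (bRec n) p 0 1 (fun x hx h1 => (classNu_bound hn (by omega) (by omega) hx h1).2.2 hp) le_rfl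
      (fun x hx h2 => by linarith [(multipole_bound hn (by omega) (by omega) hx h2).2.2])
      (fun h => absurd h (not_dOf_lt hp')) with ⟨-, h0⟩ | h
  · have := (R3 (n := n) (p := p) (x := 17 * n) (by omega) (by omega) (by omega) (by omega) (by omega)).1
    have := h0 (17 * n) (by omega)
    omega
  · linarith

/-- **`casLB(b(n),p) ≥ 0`** for `25n < p ≤ 41n`. -/
theorem casLB_ge41 {n p : ℕ} (hn : 1 ≤ n) (hp : 25 * n < p) (hp' : p ≤ 41 * n) : 0 ≤ casLB (bRec n) p := by
  rcases casLB_ge_or_noPole (bRec n) p 0 0 (fun x hx h1 => (classNu_bound hn (by omega) hp' hx h1).2.2 (by omega)) (by norm_num)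
      (fun x hx h2 => by linarith [(multipole_bound hn (by omega) hp' hx h2).2.2]) (fun _ => le_rfl) with ⟨h0, -⟩ | h
  · rw [h0]
  · linarith

end Summit.KontsevichZagierPeriods.Zeta5Search.RecordRayTop
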